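import Literature.NumberTheory.Automorphic.UnitaryTwoRamifiedTreeStabilizersPlace     -- ★ p843891 (this seat): the four (W2) heads over `rhoVertexActPlace` (brings ★ p843857, ★ p843858, ★ p843800)
import Literature.NumberTheory.Automorphic.SLTwoTreeBoundedElementFacet               -- ★ (this seat): `exists_glVertexAct_eq_self_or_swap_of_valuation_trace_sq_le`
import Literature.NumberTheory.Automorphic.RamifiedPlaceAntiFixedDichotomy            -- ★ B-p14 p843768: `exists_units_galAdicCompletionMap_complexConj_eq_neg_of_ramified`
import Literature.NumberTheory.Automorphic.SymplecticGroupCartanAdicCompletion         -- ★ `SymplecticCartan.valued_coe_uniformizer`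
import HarnessLib

/-!
# Every bounded element of `U(1,1)(L_w)` at a RAMIFIED non-split place is conjugate into `K = U ∩ GL₂(𝒪_w)` or into `K♯ = U ∩ D_η GL₂(𝒪_w) D_η⁻¹` — any residue characteristic
(Tits 1979 §2.7, §3.2, §3.9: the two maximal compact subgroups of the ramified quasi-split `U(1,1)` are a vertex and an edge stabiliser of the tree of `SL₂`; Serre II.1.3)

Topic `NumberTheory/Automorphic`; namespace `Literature.NumberTheory.Automorphic.UnitaryGroup`.  KERNEL mathematics only: theorems, no definition, no `sorry`.
Cell `pub/hodgecm-mathlib`, F0∕P3a, crux H413 = `stmt-HodgeConjecture-24833`, road W′ = «R1LL-WILD» (LEAD T9-25 (b); architect A-p16 (g28)), socket «I-5a-ram-WILD»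
(census 822e2006 §1 (B) row 3: the tame vertex cover ★ `exists_eq_mul_mul_inv_or_of_trace_mem_of_ramified` needs `|2|_w = 1`; this file does not); seat F0P3a-p04 (g14).
HONEST LABEL: HC_CM is proved only modulo the printed citations until rung 0 closes; nothing printed is asserted here.

THE MATHEMATICS (`U_w = U(σ_w, (Φ₂)_w)`, `ρ_w = rhoVertexActPlace` ★ B-p08 p843858, descent `diag(1,α) u diag(1,α)⁻¹ = s · ι_w(g)` ★ p843570, `α` anti-fixed of either type ★ p843768):
* `valuation_trace_sq_le_valuation_det_of_descent`: `|det u| = 1`, `|tr u| ≤ 1` ⟹ `|tr g|_v² ≤ |det g|_v` (the conjugate has the trace and determinant of `u`; `ι_w` raises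
  valuations to the power `e(w ∣ v)`).
* `exists_rhoVertexActPlace_eq_self_or_swap_of_trace_le_one`: `|tr u|_w ≤ 1` ⟹ `ρ_w(u)` fixes a vertex or inverts an edge (★ `exists_glVertexAct_eq_self_or_swap_of_valuation_trace_sq_le`
  + ★ `rhoVertexActPlace_eq_iff_glVertexAct_eq`).
* **`exists_conj_mem_glInt_or_mem_map_conj_glDiagonal_of_trace_le_one`** (`w` ramified, `η` ANY uniformiser): `|tr u|_w ≤ 1` ⟹ `∃ y ∈ U_w`, `y⁻¹uy ∈ GL₂(𝒪_w)` or
  `y⁻¹uy ∈ D_η GL₂(𝒪_w) D_η⁻¹` — move the fixed vertex ∕ inverted edge to `v₀`, `v₁`, `{v₀,v₁}` by ★ `exists_rhoVertexActPlace_eq'` ∕ `exists_rhoVertexActPlace_eq_of_adj` (one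
  vertex orbit, one dart orbit at a ramified place) and read the stabilisers off the (W2) heads ★ `UnitaryTwoRamifiedTreeStabilizersPlace` by the type of `α`.
The `cmDatum`-carrier cover (binder `hcov`, the tame statement of ★ `exists_vertexCover_of_ramified` minus `h2`∕`hση`) is ★ `Rogawski1990/RankOneKappaVertexCoverWild`.

## References
* [Tits1979] J. Tits, *Reductive groups over local fields*, PSPM 33.1 (1979), §2.7, §3.2, §3.9.
* [Serre1980Trees] J.-P. Serre, *Trees* (1980), Ch. II §1.3, Ch. I §6.5.
* [Kottwitz1988] R. E. Kottwitz, *Tamagawa numbers*, Ann. of Math. 127 (1988), §2.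
-/

set_option autoImplicit false

noncomputable section

open scoped WithZero ValuativeRel Matrix MatrixGroups
open Matrix WithZero ValuativeRel NumberField IsDedekindDomain

namespace Literature.NumberTheory.Automorphic.UnitaryGroup

open Literature.NumberTheory.Automorphic Literature.NumberTheory.Automorphic.HermitianLatticeTree

section Place

variable (L : Type) [Field L] [NumberField L] [IsCMField L] {v : HeightOneSpectrum (𝓞 ↥(maximalRealSubfield L))}
  (w : PlacesOver L v) (hw : IsCMField.complexConj L • w.1 = w.1)

omit [IsCMField L] in
/-- **THE DESCENT OF A BOUNDED ELEMENT IS BOUNDED**: if `diag(1,α) u diag(1,α)⁻¹ = s · ι_w(g)` with `|det u|_w = 1` and `|tr u|_w ≤ 1`, then `|tr g|_v² ≤ |det g|_v`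
(`tr` and `det` of the conjugate are those of `u`; `ι_w` raises valuations to the power `e(w|v) ≠ 0`). [cite: Serre1980Trees, Ch. II §1.3] [cite: Tits1979, §3.2] -/
theorem valuation_trace_sq_le_valuation_det_of_descent {α : w.1.adicCompletion L} (hα0 : α ≠ 0)
    {u : Matrix (Fin 2) (Fin 2) (w.1.adicCompletion L)} (hdet : Valued.v u.det = 1) (htr : Valued.v u.trace ≤ 1)
    {s : w.1.adicCompletion L} {g : Matrix (Fin 2) (Fin 2) (v.adicCompletion ↥(maximalRealSubfield L))}
    (hsg : diagonal ![1, α] * u * diagonal ![1, α⁻¹] = s • g.map (toPlace v w)) :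
    valuation (v.adicCompletion ↥(maximalRealSubfield L)) g.trace ^ 2 ≤ valuation (v.adicCompletion ↥(maximalRealSubfield L)) g.det := by
  set e := v.asIdeal.ramificationIdx' w.1.asIdeal with hedef
  have he0 : e ≠ 0 := ramificationIdx'_placesOver_ne_zero w
  have hι : ∀ x, Valued.v (toPlace v w x) = Valued.v x ^ e := valued_toPlace v w
  -- `tr` and `det` of the conjugate are those of `u`
  have htrM : (diagonal ![1, α] * u * diagonal ![1, α⁻¹]).trace = u.trace := by
    obtain ⟨e1, -, -, e4⟩ := diagonal_mul_mul_diagonal_apply u α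
    rw [trace_fin_two, trace_fin_two, e1, e4, mul_right_comm, mul_inv_cancel₀ hα0, one_mul]
  have hdetM : (diagonal ![1, α] * u * diagonal ![1, α⁻¹]).det = u.det := by
    have hD1 : (diagonal ![(1 : w.1.adicCompletion L), α]).det = α := by rw [det_diagonal, Fin.prod_univ_two]; simp
    have hD2 : (diagonal ![(1 : w.1.adicCompletion L), α⁻¹]).det = α⁻¹ := by rw [det_diagonal, Fin.prod_univ_two]; simp
    rw [det_mul, det_mul, hD1, hD2, mul_right_comm, mul_inv_cancel₀ hα0, one_mul]
  -- valuations: `v(s)·v(tr g)^e = v(tr u) ≤ 1`, `v(s)²·v(det g)^e = v(det u) = 1`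
  have htrv : Valued.v s * Valued.v g.trace ^ e = Valued.v u.trace := by
    rw [← htrM, hsg, trace_fin_two, trace_fin_two, Matrix.smul_apply, Matrix.smul_apply, Matrix.map_apply, Matrix.map_apply, smul_eq_mul, smul_eq_mul,
      ← mul_add, ← map_add, map_mul, hι]
  have hdetv : Valued.v s ^ 2 * Valued.v g.det ^ e = 1 := by
    rw [← v_det_smul_map_two (toPlace v w) hι s g, ← hsg, hdetM, hdet]
  -- conclude in `exp`-coordinates
  rw [← map_pow, ← v_le_iff_valuation_le, map_pow]
  by_cases hT : Valued.v g.trace = 0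
  · rw [hT, zero_pow two_ne_zero]; exact zero_le
  have hA : Valued.v s ≠ 0 := by
    intro h; rw [h, zero_pow two_ne_zero, zero_mul] at hdetv; exact zero_ne_one hdetv
  have hD : Valued.v g.det ≠ 0 := by
    intro h; rw [h, zero_pow he0, mul_zero] at hdetv; exact zero_ne_one hdetv
  obtain ⟨a, ha⟩ : ∃ a : ℤ, Valued.v s = exp a := ⟨_, (exp_log hA).symm⟩
  obtain ⟨t, ht⟩ : ∃ t : ℤ, Valued.v g.trace = exp t := ⟨_, (exp_log hT).symm⟩
  obtain ⟨d, hd⟩ : ∃ d : ℤ, Valued.v g.det = exp d := ⟨_, (exp_log hD).symm⟩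
  rw [ha, hd, ← WithZero.exp_nsmul, ← WithZero.exp_nsmul, ← WithZero.exp_add, ← WithZero.exp_zero, exp_inj] at hdetv
  rw [ha, ht, ← WithZero.exp_nsmul, ← WithZero.exp_add] at htrv
  have h1 : exp (a + e • t) ≤ 1 := htrv ▸ htr
  rw [← WithZero.exp_zero, exp_le_exp] at h1
  rw [ht, hd, ← WithZero.exp_nsmul, exp_le_exp]
  simp only [nsmul_eq_mul, Nat.cast_ofNat] at hdetv h1 ⊢
  have hepos : (0 : ℤ) < e := by exact_mod_cast Nat.pos_of_ne_zero he0
  nlinarith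

variable {α : w.1.adicCompletion L} (hα : galAdicCompletionMap (L := L) (IsCMField.complexConj L) hw α = -α) (hα0 : α ≠ 0)
  {ϖF : v.adicCompletion ↥(maximalRealSubfield L)} (hϖF : Valued.v ϖF = exp (-1 : ℤ))

include hϖF in
/-- **A BOUNDED ELEMENT OF `U_w` FIXES A VERTEX OR INVERTS AN EDGE of the tree of `SL₂(L⁺_v)` through `ρ_w`** (any non-split place, any `α`): for `u ∈ U_w` with
`|tr u|_w ≤ 1`, `ρ_w(u)` fixes a vertex or swaps two adjacent vertices (★ `exists_glVertexAct_eq_self_or_swap_of_valuation_trace_sq_le` on the descent of `u`).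
[cite: Serre1980Trees, Ch. II §1.3 and I.6.5] [cite: Tits1979, §3.2] -/
theorem exists_rhoVertexActPlace_eq_self_or_swap_of_trace_le_one
    (u : ↥(unitaryGroupOfForm (galAdicCompletionMap (L := L) (IsCMField.complexConj L) hw)
      (placeForm (Matrix.of fun i j : Fin 2 => if i.val + j.val + 1 = 2 then (1 : L) else 0) w.1)))
    (htr : Valued.v (((u : GL (Fin 2) (w.1.adicCompletion L)) : Matrix (Fin 2) (Fin 2) (w.1.adicCompletion L)).trace) ≤ 1) :
    (∃ M : {M : Submodule 𝒪[v.adicCompletion ↥(maximalRealSubfield L)] (Fin 2 → v.adicCompletion ↥(maximalRealSubfield L)) //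
        IsSpecialLattice (RingHom.id (v.adicCompletion ↥(maximalRealSubfield L))) ϖF !![(0 : v.adicCompletion ↥(maximalRealSubfield L)), 1; -1, 0] M},
        rhoVertexActPlace L v w hw hα hα0 hϖF u M = M) ∨
      ∃ M N : {M : Submodule 𝒪[v.adicCompletion ↥(maximalRealSubfield L)] (Fin 2 → v.adicCompletion ↥(maximalRealSubfield L)) //
        IsSpecialLattice (RingHom.id (v.adicCompletion ↥(maximalRealSubfield L))) ϖF !![(0 : v.adicCompletion ↥(maximalRealSubfield L)), 1; -1, 0] M},
        (latticeTree (RingHom.id (v.adicCompletion ↥(maximalRealSubfield L))) ϖF !![(0 : v.adicCompletion ↥(maximalRealSubfield L)), 1; -1, 0]).Adj M N ∧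
          rhoVertexActPlace L v w hw hα hα0 hϖF u M = N ∧ rhoVertexActPlace L v w hw hα hα0 hϖF u N = M := by
  haveI : IsDiscreteValuationRing 𝒪[v.adicCompletion ↥(maximalRealSubfield L)] := isDiscreteValuationRing_integer_of_compatible hϖF
  obtain ⟨s, g, hs, hsg⟩ := descent_of_mem_unitaryGroupOfForm_antidiag L v w hw hα hα0 _ (coe_mem_unitaryGroupOfForm_antidiag_two_of_mem_placeForm L w hw u)
  have hbd := valuation_trace_sq_le_valuation_det_of_descent L w hα0 (v_det_coe_eq_one_of_mem_placeForm L w hw u) htr hsg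
  have hρ := rhoVertexActPlace_eq_iff_glVertexAct_eq L v w hw hα hα0 hϖF u hs hsg
  rcases exists_glVertexAct_eq_self_or_swap_of_valuation_trace_sq_le (isUniformizingElement_of_v_eq hϖF) g hbd with ⟨M, hM⟩ | ⟨M, N, hMN, h1, h2⟩
  · exact Or.inl ⟨M, (hρ M M).2 hM⟩
  · exact Or.inr ⟨M, N, hMN, (hρ M N).2 h1, (hρ N M).2 h2⟩

include hα hα0 hϖF in
/-- **EVERY BOUNDED ELEMENT OF `U_w` IS CONJUGATE INTO `K = U_w ∩ GL₂(𝒪_w)` OR INTO `K♯ = U_w ∩ D_η GL₂(𝒪_w) D_η⁻¹`** at a RAMIFIED non-split place `w` of EITHER dyadic type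
(`η` any uniformiser of `L_w`, `D_η = diag(1, η)`): if `|tr u|_w ≤ 1` then `y⁻¹ u y ∈ K` or `y⁻¹ u y ∈ K♯` for some `y ∈ U_w`.  This is the residue-characteristic-free
replacement of the tame vertex cover ★ `exists_eq_mul_mul_inv_or_of_trace_mem_of_ramified` (which needs `|2|_w = 1`): `ρ_w(u)` fixes a vertex or inverts an edge (previous
theorem); vertices and darts are single `U_w`-orbits (★ `exists_rhoVertexActPlace_eq'`, ★ `exists_rhoVertexActPlace_eq_of_adj`); and the stabilisers of `v₀`, `v₁`, `{v₀,v₁}`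
are `K`∕`K♯` by the type of the anti-fixed `α` (★ (W2) `UnitaryTwoRamifiedTreeStabilizersPlace`). [cite: Tits1979, §2.7, §3.2 and §3.9] [cite: Serre1980Trees, Ch. II §1.3]
[cite: Kottwitz1988, §2] -/
theorem exists_conj_mem_glInt_or_mem_map_conj_glDiagonal_of_trace_le_one (he : v.asIdeal.ramificationIdx' w.1.asIdeal ≠ 1)
    (hvα : Valued.v α = 1 ∨ Valued.v α = exp (-1 : ℤ)) (η : (w.1.adicCompletion L)ˣ) (hη : Valued.v (η : w.1.adicCompletion L) = exp (-1 : ℤ))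
    (u : ↥(unitaryGroupOfForm (galAdicCompletionMap (L := L) (IsCMField.complexConj L) hw)
      (placeForm (Matrix.of fun i j : Fin 2 => if i.val + j.val + 1 = 2 then (1 : L) else 0) w.1)))
    (htr : Valued.v (((u : GL (Fin 2) (w.1.adicCompletion L)) : Matrix (Fin 2) (Fin 2) (w.1.adicCompletion L)).trace) ≤ 1) :
    ∃ y : ↥(unitaryGroupOfForm (galAdicCompletionMap (L := L) (IsCMField.complexConj L) hw)
      (placeForm (Matrix.of fun i j : Fin 2 => if i.val + j.val + 1 = 2 then (1 : L) else 0) w.1)),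
      ((y⁻¹ * u * y : ↥(unitaryGroupOfForm (galAdicCompletionMap (L := L) (IsCMField.complexConj L) hw)
          (placeForm (Matrix.of fun i j : Fin 2 => if i.val + j.val + 1 = 2 then (1 : L) else 0) w.1))) : GL (Fin 2) (w.1.adicCompletion L)) ∈
            glInt 2 (w.1.adicCompletion L) ∨
        ((y⁻¹ * u * y : ↥(unitaryGroupOfForm (galAdicCompletionMap (L := L) (IsCMField.complexConj L) hw)
          (placeForm (Matrix.of fun i j : Fin 2 => if i.val + j.val + 1 = 2 then (1 : L) else 0) w.1))) : GL (Fin 2) (w.1.adicCompletion L)) ∈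
            (glInt 2 (w.1.adicCompletion L)).map (MulAut.conj (glDiagonal 2 (w.1.adicCompletion L) ![1, η])).toMonoidHom := by
  haveI : IsDiscreteValuationRing 𝒪[v.adicCompletion ↥(maximalRealSubfield L)] := isDiscreteValuationRing_integer_of_compatible hϖF
  have hϖu : IsUniformizingElement ϖF := isUniformizingElement_of_v_eq hϖF
  have h0 : ϖF ≠ 0 := hϖu.ne_zero
  -- the two root vertices `v₀ = 𝒪²`, `v₁ = 𝒪 ⊕ ϖ𝒪`
  have hv₀S : IsSpecialLattice (RingHom.id (v.adicCompletion ↥(maximalRealSubfield L))) ϖF !![(0 : v.adicCompletion ↥(maximalRealSubfield L)), 1; -1, 0]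
      (latt (1 : Matrix (Fin 2) (Fin 2) (v.adicCompletion ↥(maximalRealSubfield L)))) := by
    have h := isSpecialLattice_latt_of_valuation_det h0 (1 : GL (Fin 2) (v.adicCompletion ↥(maximalRealSubfield L))) (e := 0) (Or.inl rfl)
      (by rw [Units.val_one, det_one, zpow_zero])
    rwa [Units.val_one] at h
  have hv₁S : IsSpecialLattice (RingHom.id (v.adicCompletion ↥(maximalRealSubfield L))) ϖF !![(0 : v.adicCompletion ↥(maximalRealSubfield L)), 1; -1, 0]
      (latt (diagonal ![(1 : v.adicCompletion ↥(maximalRealSubfield L)), ϖF])) := by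
    have h := isSpecialLattice_latt_of_valuation_det h0 (glDiagonal 2 (v.adicCompletion ↥(maximalRealSubfield L)) ![1, Units.mk0 ϖF h0]) (e := 1) (Or.inr rfl)
      (by rw [coe_glDiagonal_one_two, Units.val_mk0, det_diagonal, Fin.prod_univ_two]; simp)
    rwa [coe_glDiagonal_one_two, Units.val_mk0] at h
  set v₀ : {M : Submodule 𝒪[v.adicCompletion ↥(maximalRealSubfield L)] (Fin 2 → v.adicCompletion ↥(maximalRealSubfield L)) //
      IsSpecialLattice (RingHom.id (v.adicCompletion ↥(maximalRealSubfield L))) ϖF !![(0 : v.adicCompletion ↥(maximalRealSubfield L)), 1; -1, 0] M} := ⟨_, hv₀S⟩ with hv₀def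
  set v₁ : {M : Submodule 𝒪[v.adicCompletion ↥(maximalRealSubfield L)] (Fin 2 → v.adicCompletion ↥(maximalRealSubfield L)) //
      IsSpecialLattice (RingHom.id (v.adicCompletion ↥(maximalRealSubfield L))) ϖF !![(0 : v.adicCompletion ↥(maximalRealSubfield L)), 1; -1, 0] M} := ⟨_, hv₁S⟩ with hv₁def
  have hv₀ : v₀.1 = latt (1 : Matrix (Fin 2) (Fin 2) (v.adicCompletion ↥(maximalRealSubfield L))) := rfl
  have hv₁ : v₁.1 = latt (diagonal ![(1 : v.adicCompletion ↥(maximalRealSubfield L)), ϖF]) := rfl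
  -- conjugation bookkeeping for `ρ`
  have hconj : ∀ (y : ↥(unitaryGroupOfForm (galAdicCompletionMap (L := L) (IsCMField.complexConj L) hw)
      (placeForm (Matrix.of fun i j : Fin 2 => if i.val + j.val + 1 = 2 then (1 : L) else 0) w.1))) (x : {M : Submodule 𝒪[v.adicCompletion ↥(maximalRealSubfield L)] (Fin 2 → v.adicCompletion ↥(maximalRealSubfield L)) //
      IsSpecialLattice (RingHom.id (v.adicCompletion ↥(maximalRealSubfield L))) ϖF !![(0 : v.adicCompletion ↥(maximalRealSubfield L)), 1; -1, 0] M}),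
      rhoVertexActPlace L v w hw hα hα0 hϖF (y⁻¹ * u * y) x =
        rhoVertexActPlace L v w hw hα hα0 hϖF y⁻¹ (rhoVertexActPlace L v w hw hα hα0 hϖF u (rhoVertexActPlace L v w hw hα hα0 hϖF y x)) := fun y x => by
    rw [rhoVertexActPlace_mul, rhoVertexActPlace_mul]
  have hinv : ∀ (y : ↥(unitaryGroupOfForm (galAdicCompletionMap (L := L) (IsCMField.complexConj L) hw)
      (placeForm (Matrix.of fun i j : Fin 2 => if i.val + j.val + 1 = 2 then (1 : L) else 0) w.1))) (x : {M : Submodule 𝒪[v.adicCompletion ↥(maximalRealSubfield L)] (Fin 2 → v.adicCompletion ↥(maximalRealSubfield L)) //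
      IsSpecialLattice (RingHom.id (v.adicCompletion ↥(maximalRealSubfield L))) ϖF !![(0 : v.adicCompletion ↥(maximalRealSubfield L)), 1; -1, 0] M}),
      rhoVertexActPlace L v w hw hα hα0 hϖF y⁻¹ (rhoVertexActPlace L v w hw hα hα0 hϖF y x) = x := fun y x => by
    rw [← rhoVertexActPlace_mul, inv_mul_cancel, rhoVertexActPlace_one]
  rcases exists_rhoVertexActPlace_eq_self_or_swap_of_trace_le_one L w hw hα hα0 hϖF u htr with ⟨M, hM⟩ | ⟨M, N, hMN, h1, h2⟩
  · -- a fixed vertex `M`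
    rcases hvα with hvα | hvα
    · -- `√u`-type: move `M` to `v₀`; `Stab(v₀) = K`
      obtain ⟨y, hy⟩ := exists_rhoVertexActPlace_eq' L v w hw hα hα0 hϖF he v₀ M
      refine ⟨y, Or.inl ((forall_coe_mem_glInt_iff_rhoVertexActPlace_root_eq L v w hw hα hα0 hϖF v₀ hv₀ hvα (y⁻¹ * u * y)).2 ?_)⟩
      rw [hconj, hy, hM, ← hy, hinv]
    · -- `√π`-type: move `M` to `v₁`; `Stab(v₁) = K♯`
      obtain ⟨y, hy⟩ := exists_rhoVertexActPlace_eq' L v w hw hα hα0 hϖF he v₁ M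
      refine ⟨y, Or.inr ((forall_coe_mem_map_conj_glDiagonal_iff_rhoVertexActPlace_next_eq L v w hw hα hα0 hϖF v₁ hv₁ he hvα η hη (y⁻¹ * u * y)).2 ?_)⟩
      rw [hconj, hy, hM, ← hy, hinv]
  · -- an inverted edge `{M, N}`: move it to `{v₀, v₁}`
    obtain ⟨y, hy0, hy1⟩ := exists_rhoVertexActPlace_eq_of_adj L v w hw hα hα0 hϖF he v₀ v₁ hv₀ hv₁ hMN
    have e0 : rhoVertexActPlace L v w hw hα hα0 hϖF (y⁻¹ * u * y) v₀ = v₁ := by rw [hconj, hy0, h1, ← hy1, hinv]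
    have e1 : rhoVertexActPlace L v w hw hα hα0 hϖF (y⁻¹ * u * y) v₁ = v₀ := by rw [hconj, hy1, h2, ← hy0, hinv]
    rcases hvα with hvα | hvα
    · -- `√u`-type: `Stab{v₀,v₁} = K♯`
      refine ⟨y, Or.inr ((forall_coe_mem_map_conj_glDiagonal_iff_sym2_rhoVertexActPlace_eq L v w hw hα hα0 hϖF v₀ v₁ hv₀ hv₁ he hvα η hη (y⁻¹ * u * y)).2 ?_)⟩
      rw [e0, e1, Sym2.eq_swap]
    · -- `√π`-type: `Stab{v₁,v₀} = K`
      refine ⟨y, Or.inl ((forall_coe_mem_glInt_iff_sym2_rhoVertexActPlace_eq L v w hw hα hα0 hϖF v₀ v₁ hv₀ hv₁ he hvα (y⁻¹ * u * y)).2 ?_)⟩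
      rw [e0, e1, Sym2.eq_swap]

end Place

end Literature.NumberTheory.Automorphic.UnitaryGroup
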